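import Mathlib.Combinatorics.SimpleGraph.Connectivity.Connected
import Literature.Topology.FourManifolds.KhResolutions
import HarnessLib

/-!
# State circles under a flip of one smoothing (trunk T-4MAN / FourManL)

Bookkeeping for the Khovanov–Lee tower `KhResolutions → KhComplex → LeeRasmussen` on Gauss
diagrams: how the state circles (connected components of the state graph on arcs,
`GaussDiagram.stateGraph`) change when the smoothing at one chord `i` of a state `σ` is flipped
from `0` to `1` (`σ' = Function.update σ i true`).

* Abstract part (any simple graph): `MergedReach Γ a b`, the reachability relation of `Γ`
  after identifying the components of `a` and `b`; it is an equivalence relation, and if `Γ'`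
  is obtained from `Γ` by *trading* the two edges `{a, x}, {b, y}` for `{a, y}, {b, x}`
  (`x, y` on the components of `a`, `b`), then `Γ'`-reachability is contained in
  `MergedReach Γ a b` (`mergedReach_of_reachable_trade`) and equals it as soon as `a, b` are
  `Γ'`-connected (`reachable_trade_iff_mergedReach`).
* Concrete part: the state graphs of `σ` and `σ'` differ exactly by such a trade at the four
  local arcs of chord `i` (`stateGraph_adj_update_imp`, `stateGraph_adj_imp_update`), whence:
  after a **merge** (`IsMergeAt`) the circles of `σ'` are those of `σ` with the two circles
  through chord `i` united (`IsMergeAt.reachable_update_iff`), and dually before a **split**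
  (`IsSplitAt.reachable_iff`); in all cases `σ`-circles refine merged `σ'`-circles and
  conversely (`mergedReach_of_reachable_update`, `mergedReach_update_of_reachable`).

These are the planarity-free halves of the statement that incident vertices of the cube of
resolutions differ by one index-`1` Morse modification (Viro (2004), §5.2; Bar-Natan (2002),
§3.1; Khovanov (2000), §4.2); they are used downstream for the behaviour of the quantum
degree and of the `X`-action along the Lee differential.

## Sources

* O. Viro, *Khovanov homology, its definitions and ramifications*, Fund. Math. 184 (2004),
  §5.2 (incidence of enhanced states; the resolutions of adjacent states differ by a single
  Morse modification).
* D. Bar-Natan, *On Khovanov's categorification of the Jones polynomial*, AGT 2 (2002), §3.1.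
* Mathlib: `SimpleGraph.Reachable`, `SimpleGraph.ConnectedComponent`, `SimpleGraph.fromRel`;
  Mathlib has no lemma describing the components of a graph after trading two edges
  (searched `sup_edge`, `Reachable`, `deleteEdges`), so the abstract part is proved here.

## Design choices

* Everything is total on `GaussDiagram` (virtual diagrams included) and uses no named fact.
* The four local arcs at chord `i` are `arcIn (overPos i)`, `arcOut (overPos i)` (the two
  local strands, as in `IsMergeAt`) and their far ends `flipFst σ i`, `flipSnd σ i`, which
  depend on whether the smoothing of `σ` at `i` is Seifert's (`isSeifert`).
* Statements are phrased with `SimpleGraph.Reachable` and unordered pairs `Sym2`; no new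
  `Fintype`/`Decidable` instances are introduced.
-/

open Function Set

noncomputable section

namespace Literature.Topology.FourManifolds

/-! ## Abstract part: merging two components, trading two edges -/

section Abstract

variable {V : Type*}

/-- **Merged reachability**: `MergedReach Γ a b u v` holds if `u` and `v` are connected in `Γ`
after the components of `a` and `b` have been identified, i.e. `u ~ v`, or `u ~ a` and
`b ~ v`, or `u ~ b` and `a ~ v` (`~` is `Γ.Reachable`). [folklore] -/
def MergedReach (Γ : SimpleGraph V) (a b : V) (u v : V) : Prop :=
  Γ.Reachable u v ∨ (Γ.Reachable u a ∧ Γ.Reachable b v) ∨ (Γ.Reachable u b ∧ Γ.Reachable a v)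

variable {Γ Γ' : SimpleGraph V} {a b x y u v w : V}

/-- Reachable vertices are merged-reachable. [folklore] -/
theorem MergedReach.of_reachable (h : Γ.Reachable u v) : MergedReach Γ a b u v :=
  Or.inl h

/-- Merged reachability is reflexive. [folklore] -/
theorem MergedReach.refl (Γ : SimpleGraph V) (a b u : V) : MergedReach Γ a b u u :=
  Or.inl (SimpleGraph.Reachable.refl u)

/-- `a` and `b` are merged-reachable. [folklore] -/
theorem MergedReach.left_right (Γ : SimpleGraph V) (a b : V) : MergedReach Γ a b a b :=
  Or.inr (Or.inl ⟨SimpleGraph.Reachable.refl a, SimpleGraph.Reachable.refl b⟩)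

/-- Merged reachability is symmetric. [folklore] -/
theorem MergedReach.symm (h : MergedReach Γ a b u v) : MergedReach Γ a b v u := by
  rcases h with h | ⟨h, h'⟩ | ⟨h, h'⟩
  · exact Or.inl h.symm
  · exact Or.inr (Or.inr ⟨h'.symm, h.symm⟩)
  · exact Or.inr (Or.inl ⟨h'.symm, h.symm⟩)

/-- Merged reachability is transitive. [folklore] -/
theorem MergedReach.trans (h₁ : MergedReach Γ a b u v) (h₂ : MergedReach Γ a b v w) :
    MergedReach Γ a b u w := by
  rcases h₁ with h₁ | ⟨h₁, h₁'⟩ | ⟨h₁, h₁'⟩ <;> rcases h₂ with h₂ | ⟨h₂, h₂'⟩ | ⟨h₂, h₂'⟩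
  · exact Or.inl (h₁.trans h₂)
  · exact Or.inr (Or.inl ⟨h₁.trans h₂, h₂'⟩)
  · exact Or.inr (Or.inr ⟨h₁.trans h₂, h₂'⟩)
  · exact Or.inr (Or.inl ⟨h₁, h₁'.trans h₂⟩)
  · exact Or.inr (Or.inl ⟨h₁, h₂'⟩)
  · exact Or.inl (h₁.trans h₂')
  · exact Or.inr (Or.inr ⟨h₁, h₁'.trans h₂⟩)
  · exact Or.inl (h₁.trans h₂')
  · exact Or.inr (Or.inr ⟨h₁, h₂'⟩)

/-- Merged reachability is an equivalence relation. [folklore] -/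
theorem MergedReach.equivalence (Γ : SimpleGraph V) (a b : V) :
    Equivalence (MergedReach Γ a b) :=
  ⟨MergedReach.refl Γ a b, MergedReach.symm, MergedReach.trans⟩

/-- If `a` and `b` are already connected, merged reachability is plain reachability. [folklore] -/
theorem MergedReach.reachable (hab : Γ.Reachable a b) (h : MergedReach Γ a b u v) :
    Γ.Reachable u v := by
  rcases h with h | ⟨h, h'⟩ | ⟨h, h'⟩
  · exact h
  · exact h.trans (hab.trans h')
  · exact h.trans (hab.symm.trans h')

/-- Minimality of reachability: an equivalence relation containing adjacency contains
reachability. [folklore] -/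
theorem rel_of_reachable {R : V → V → Prop} (hR : Equivalence R)
    (h : ∀ u v, Γ.Adj u v → R u v) (huv : Γ.Reachable u v) : R u v := by
  obtain ⟨p⟩ := huv
  induction p with
  | nil => exact hR.refl _
  | cons hadj _ ih => exact hR.trans (h _ _ hadj) ih

/-- **Edge trade, easy direction.** Suppose every edge of `Γ'` is an edge of `Γ` or one of the
two pairs `{a, y}`, `{b, x}`, where `x` lies on the `Γ`-component of `a` and `y` on that of `b`.
Then `Γ'`-connected vertices are merged-reachable in `Γ` (every `Γ'`-component is contained in
a `Γ`-component or in the union of the components of `a` and `b`). [folklore] -/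
theorem mergedReach_of_reachable_trade
    (hadj : ∀ u v, Γ'.Adj u v → Γ.Adj u v ∨ s(u, v) = s(a, y) ∨ s(u, v) = s(b, x))
    (hax : Γ.Reachable a x) (hby : Γ.Reachable b y) (h : Γ'.Reachable u v) :
    MergedReach Γ a b u v := by
  refine rel_of_reachable (MergedReach.equivalence Γ a b) (fun u v huv ↦ ?_) h
  rcases hadj u v huv with h | h | h
  · exact Or.inl h.reachable
  · rcases Sym2.eq_iff.1 h with ⟨rfl, rfl⟩ | ⟨rfl, rfl⟩
    · exact Or.inr (Or.inl ⟨SimpleGraph.Reachable.refl _, hby⟩)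
    · exact Or.inr (Or.inr ⟨hby.symm, SimpleGraph.Reachable.refl _⟩)
  · rcases Sym2.eq_iff.1 h with ⟨rfl, rfl⟩ | ⟨rfl, rfl⟩
    · exact Or.inr (Or.inr ⟨SimpleGraph.Reachable.refl _, hax⟩)
    · exact Or.inr (Or.inl ⟨hax.symm, SimpleGraph.Reachable.refl _⟩)

/-- **Edge trade, merge direction.** If every edge of `Γ` is an edge of `Γ'` or one of
`{a, x}`, `{b, y}`, the traded pairs `{a, y}`, `{b, x}` are `Γ'`-connected and moreover `a` and
`b` are `Γ'`-connected, then `Γ`-reachability implies `Γ'`-reachability. [folklore] -/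
theorem reachable_trade_of_reachable
    (hadj' : ∀ u v, Γ.Adj u v → Γ'.Adj u v ∨ s(u, v) = s(a, x) ∨ s(u, v) = s(b, y))
    (hay : Γ'.Reachable a y) (hbx : Γ'.Reachable b x) (hab : Γ'.Reachable a b)
    (h : Γ.Reachable u v) : Γ'.Reachable u v :=
  (mergedReach_of_reachable_trade hadj' hay hbx h).reachable hab

/-- **Edge trade, the merge case.** Under the hypotheses of the two previous lemmas (the edge
sets of `Γ` and `Γ'` differ exactly by trading `{a, x}, {b, y}` for `{a, y}, {b, x}`, with
`x ~ a`, `y ~ b` in `Γ` and `a ~ y`, `b ~ x`, `a ~ b` in `Γ'`), `Γ'`-reachability *is* merged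
`Γ`-reachability: the components of `Γ'` are those of `Γ` with the components of `a` and `b`
united. [folklore] -/
theorem reachable_trade_iff_mergedReach
    (hadj : ∀ u v, Γ'.Adj u v → Γ.Adj u v ∨ s(u, v) = s(a, y) ∨ s(u, v) = s(b, x))
    (hadj' : ∀ u v, Γ.Adj u v → Γ'.Adj u v ∨ s(u, v) = s(a, x) ∨ s(u, v) = s(b, y))
    (hax : Γ.Reachable a x) (hby : Γ.Reachable b y) (hay : Γ'.Reachable a y)
    (hbx : Γ'.Reachable b x) (hab : Γ'.Reachable a b) :
    Γ'.Reachable u v ↔ MergedReach Γ a b u v := by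
  refine ⟨mergedReach_of_reachable_trade hadj hax hby, fun h ↦ ?_⟩
  have hm : ∀ {u v}, Γ.Reachable u v → Γ'.Reachable u v := fun h ↦
    reachable_trade_of_reachable hadj' hay hbx hab h
  rcases h with h | ⟨h, h'⟩ | ⟨h, h'⟩
  · exact hm h
  · exact (hm h).trans (hab.trans (hm h'))
  · exact (hm h).trans (hab.symm.trans (hm h'))

end Abstract

/-! ## Concrete part: the state graphs of `σ` and `σ[i ↦ 1]` -/

namespace GaussDiagram

variable (G : GaussDiagram)

/-- The **gluing clause** of the reconnection relation `stateAdj σ` at the marked point `q`: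
the ordered pairs of arcs glued at `q` by the smoothing of the chord through `q` (Seifert
smoothing: `arcIn q ~ arcOut (partner q)`, listed in both orders; otherwise
`arcIn q ~ arcIn (partner q)` and `arcOut q ~ arcOut (partner q)`), so that
`stateAdj σ u v ↔ u ≠ v ∧ ∃ q, glueRel σ q u v` (`stateAdj_iff`). Viro (2004), §2, §5. [cite: Viro2004, §5.2] -/
def glueRel (σ : G.State) (q : Fin (2 * G.n)) (u v : G.Arc) : Prop :=
  (G.isSeifert σ (G.chordOf q) = true ∧
      ((u = G.arcIn q ∧ v = G.arcOut (G.partner q)) ∨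
        (v = G.arcIn q ∧ u = G.arcOut (G.partner q)))) ∨
    (G.isSeifert σ (G.chordOf q) = false ∧
      ((u = G.arcIn q ∧ v = G.arcIn (G.partner q)) ∨
        (u = G.arcOut q ∧ v = G.arcOut (G.partner q))))

/-- The reconnection relation is "distinct and glued at some marked point". [folklore] -/
theorem stateAdj_iff (σ : G.State) (u v : G.Arc) :
    G.stateAdj σ u v ↔ u ≠ v ∧ ∃ q, G.glueRel σ q u v :=
  Iff.rfl

/-- Adjacency in the state graph: distinct arcs glued (in some order) at some marked point. [folklore] -/
theorem stateGraph_adj (σ : G.State) (u v : G.Arc) :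
    (G.stateGraph σ).Adj u v ↔ u ≠ v ∧ ∃ q, G.glueRel σ q u v ∨ G.glueRel σ q v u := by
  rw [stateGraph, SimpleGraph.fromRel_adj, stateAdj_iff, stateAdj_iff]
  constructor
  · rintro ⟨hne, ⟨-, q, hq⟩ | ⟨-, q, hq⟩⟩
    · exact ⟨hne, q, Or.inl hq⟩
    · exact ⟨hne, q, Or.inr hq⟩
  · rintro ⟨hne, q, hq | hq⟩
    · exact ⟨hne, Or.inl ⟨hne, q, hq⟩⟩
    · exact ⟨hne, Or.inr ⟨hne.symm, q, hq⟩⟩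

/-- Arcs glued at some marked point are connected in the state graph (equal or adjacent). [folklore] -/
theorem reachable_of_glueRel (σ : G.State) {q : Fin (2 * G.n)} {u v : G.Arc}
    (h : G.glueRel σ q u v) : (G.stateGraph σ).Reachable u v := by
  by_cases huv : u = v
  · rw [huv]
  · exact SimpleGraph.Adj.reachable ((G.stateGraph_adj σ u v).2 ⟨huv, q, Or.inl h⟩)

/-- The gluing clause at a marked point off chord `i` does not see the smoothing at `i`. [folklore] -/
theorem glueRel_update_of_ne (σ : G.State) {i : Fin G.n} (c : Bool) {q : Fin (2 * G.n)}
    (hq : G.chordOf q ≠ i) (u v : G.Arc) :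
    G.glueRel (Function.update σ i c) q u v ↔ G.glueRel σ q u v := by
  simp only [glueRel, G.isSeifert_update_of_ne σ c hq]

/-- The chord through `q` is `i` iff `q` is one of the two ends of chord `i`. [folklore] -/
theorem chordOf_eq_iff (q : Fin (2 * G.n)) (i : Fin G.n) :
    G.chordOf q = i ↔ q = G.overPos i ∨ q = G.underPos i := by
  constructor
  · rintro rfl
    rcases G.chordOf_spec q with h | h
    · exact Or.inl h.symm
    · exact Or.inr h.symm
  · rintro (rfl | rfl)
    · exact G.chordOf_overPos i
    · exact G.chordOf_underPos i

/-- Flipping the smoothing at chord `i` flips the Seifert predicate at `i`. [folklore] -/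
theorem isSeifert_update_self (σ : G.State) (i : Fin G.n) (hσ : σ i = false) :
    G.isSeifert (Function.update σ i true) i = !G.isSeifert σ i := by
  simp only [isSeifert, Function.update_self, hσ]
  cases (G.sign i == 1) <;> rfl

/-- The **far end of the first local strand** at chord `i` in the state `σ`: the arc glued to
`arcIn (overPos i)` by the smoothing of `σ` at `i` (`arcOut (underPos i)` for Seifert's
smoothing, `arcIn (underPos i)` otherwise). Viro (2004), §5.2. [cite: Viro2004, §5.2] -/
def flipFst (σ : G.State) (i : Fin G.n) : G.Arc :=
  if G.isSeifert σ i = true then G.arcOut (G.underPos i) else G.arcIn (G.underPos i)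

/-- The **far end of the second local strand** at chord `i` in the state `σ`: the arc glued to
`arcOut (overPos i)` by the smoothing of `σ` at `i` (`arcIn (underPos i)` for Seifert's
smoothing, `arcOut (underPos i)` otherwise). Viro (2004), §5.2. [cite: Viro2004, §5.2] -/
def flipSnd (σ : G.State) (i : Fin G.n) : G.Arc :=
  if G.isSeifert σ i = true then G.arcIn (G.underPos i) else G.arcOut (G.underPos i)

/-- After the flip the first strand is glued to the old far end of the second strand. [folklore] -/
theorem flipFst_update (σ : G.State) (i : Fin G.n) (hσ : σ i = false) :
    G.flipFst (Function.update σ i true) i = G.flipSnd σ i := by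
  simp only [flipFst, flipSnd, G.isSeifert_update_self σ i hσ]
  cases G.isSeifert σ i <;> rfl

/-- After the flip the second strand is glued to the old far end of the first strand. [folklore] -/
theorem flipSnd_update (σ : G.State) (i : Fin G.n) (hσ : σ i = false) :
    G.flipSnd (Function.update σ i true) i = G.flipFst σ i := by
  simp only [flipFst, flipSnd, G.isSeifert_update_self σ i hσ]
  cases G.isSeifert σ i <;> rfl

/-- The gluings at chord `i` in any state `τ` are (at most) the two pairs
`{arcIn (overPos i), flipFst τ i}` and `{arcOut (overPos i), flipSnd τ i}`. [folklore] -/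
theorem glueRel_chord (τ : G.State) {i : Fin G.n} {q : Fin (2 * G.n)} (hq : G.chordOf q = i)
    {u v : G.Arc} (h : G.glueRel τ q u v) :
    s(u, v) = s(G.arcIn (G.overPos i), G.flipFst τ i) ∨
      s(u, v) = s(G.arcOut (G.overPos i), G.flipSnd τ i) := by
  rw [chordOf_eq_iff] at hq
  unfold glueRel flipFst flipSnd at *
  rcases hq with rfl | rfl
  · rw [chordOf_overPos, partner_overPos] at h
    cases hS : G.isSeifert τ i
    · simp only [hS, Bool.false_eq_true, false_and, false_or, true_and, if_false] at h ⊢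
      rcases h with ⟨rfl, rfl⟩ | ⟨rfl, rfl⟩
      · exact Or.inl rfl
      · exact Or.inr rfl
    · simp only [hS, true_and, Bool.true_eq_false, false_and, or_false, if_true] at h ⊢
      rcases h with ⟨rfl, rfl⟩ | ⟨rfl, rfl⟩
      · exact Or.inl rfl
      · exact Or.inl Sym2.eq_swap
  · rw [chordOf_underPos, partner_underPos] at h
    cases hS : G.isSeifert τ i
    · simp only [hS, Bool.false_eq_true, false_and, false_or, true_and, if_false] at h ⊢
      rcases h with ⟨rfl, rfl⟩ | ⟨rfl, rfl⟩
      · exact Or.inl Sym2.eq_swap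
      · exact Or.inr Sym2.eq_swap
    · simp only [hS, true_and, Bool.true_eq_false, false_and, or_false, if_true] at h ⊢
      rcases h with ⟨rfl, rfl⟩ | ⟨rfl, rfl⟩
      · exact Or.inr Sym2.eq_swap
      · exact Or.inr rfl

/-- The first local strand is connected to its far end. [folklore] -/
theorem reachable_arcIn_flipFst (τ : G.State) (i : Fin G.n) :
    (G.stateGraph τ).Reachable (G.arcIn (G.overPos i)) (G.flipFst τ i) := by
  unfold flipFst
  cases hS : G.isSeifert τ i
  · refine G.reachable_of_glueRel τ (q := G.overPos i) (Or.inr ⟨?_, Or.inl ⟨rfl, ?_⟩⟩)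
    · rwa [chordOf_overPos]
    · rw [partner_overPos]; rfl
  · refine G.reachable_of_glueRel τ (q := G.overPos i) (Or.inl ⟨?_, Or.inl ⟨rfl, ?_⟩⟩)
    · rwa [chordOf_overPos]
    · rw [partner_overPos]; rfl

/-- The second local strand is connected to its far end. [folklore] -/
theorem reachable_arcOut_flipSnd (τ : G.State) (i : Fin G.n) :
    (G.stateGraph τ).Reachable (G.arcOut (G.overPos i)) (G.flipSnd τ i) := by
  unfold flipSnd
  cases hS : G.isSeifert τ i
  · refine G.reachable_of_glueRel τ (q := G.overPos i) (Or.inr ⟨?_, Or.inr ⟨rfl, ?_⟩⟩)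
    · rwa [chordOf_overPos]
    · rw [partner_overPos]; rfl
  · refine (G.reachable_of_glueRel τ (q := G.underPos i) (Or.inl ⟨?_, Or.inl ⟨rfl, ?_⟩⟩)).symm
    · rwa [chordOf_underPos]
    · rw [partner_underPos]

variable {G}

/-- **The state graphs of `σ` and `σ[i ↦ 1]` differ by an edge trade**, first half: every edge
of the new state graph is an old edge or one of the two new gluings at chord `i`. [folklore] -/
theorem stateGraph_adj_update_imp {σ : G.State} {i : Fin G.n} (hσ : σ i = false) (u v : G.Arc)
    (h : (G.stateGraph (Function.update σ i true)).Adj u v) :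
    (G.stateGraph σ).Adj u v ∨ s(u, v) = s(G.arcIn (G.overPos i), G.flipSnd σ i) ∨
      s(u, v) = s(G.arcOut (G.overPos i), G.flipFst σ i) := by
  rw [stateGraph_adj] at h ⊢
  obtain ⟨hne, q, hq⟩ := h
  by_cases hqi : G.chordOf q = i
  · rw [← G.flipFst_update σ i hσ, ← G.flipSnd_update σ i hσ]
    rcases hq with hq | hq
    · exact Or.inr (G.glueRel_chord _ hqi hq)
    · rw [Sym2.eq_swap (a := u)]
      exact Or.inr (G.glueRel_chord _ hqi hq)
  · rw [G.glueRel_update_of_ne σ true hqi, G.glueRel_update_of_ne σ true hqi] at hq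
    exact Or.inl ⟨hne, q, hq⟩

/-- **The state graphs of `σ` and `σ[i ↦ 1]` differ by an edge trade**, second half: every
edge of the old state graph is a new edge or one of the two old gluings at chord `i`. [folklore] -/
theorem stateGraph_adj_imp_update {σ : G.State} {i : Fin G.n} (u v : G.Arc)
    (h : (G.stateGraph σ).Adj u v) :
    (G.stateGraph (Function.update σ i true)).Adj u v ∨
      s(u, v) = s(G.arcIn (G.overPos i), G.flipFst σ i) ∨
      s(u, v) = s(G.arcOut (G.overPos i), G.flipSnd σ i) := by
  rw [stateGraph_adj] at h ⊢
  obtain ⟨hne, q, hq⟩ := h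
  by_cases hqi : G.chordOf q = i
  · rcases hq with hq | hq
    · exact Or.inr (G.glueRel_chord _ hqi hq)
    · rw [Sym2.eq_swap (a := u)]
      exact Or.inr (G.glueRel_chord _ hqi hq)
  · rw [← G.glueRel_update_of_ne σ true hqi u v, ← G.glueRel_update_of_ne σ true hqi v u] at hq
    exact Or.inl ⟨hne, q, hq⟩

/-- **Circles after a flip refine merged circles before it.** For every state `σ` and every
`0`-smoothed chord `i`, two arcs on a common circle of `σ[i ↦ 1]` lie on a common circle of
`σ`, or one lies on the circle of the strand `arcIn (overPos i)` and the other on the circle of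
the strand `arcOut (overPos i)` (the flip is a single Morse modification at chord `i`).
Viro (2004), §5.2. [cite: Viro2004, §5.2] -/
theorem mergedReach_of_reachable_update {σ : G.State} {i : Fin G.n} (hσ : σ i = false)
    {u v : G.Arc} (h : (G.stateGraph (Function.update σ i true)).Reachable u v) :
    MergedReach (G.stateGraph σ) (G.arcIn (G.overPos i)) (G.arcOut (G.overPos i)) u v :=
  mergedReach_of_reachable_trade (stateGraph_adj_update_imp hσ) (G.reachable_arcIn_flipFst σ i)
    (G.reachable_arcOut_flipSnd σ i) h

/-- **Circles before a flip refine merged circles after it** (the statement dual to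
`mergedReach_of_reachable_update`). Viro (2004), §5.2. [cite: Viro2004, §5.2] -/
theorem mergedReach_update_of_reachable {σ : G.State} {i : Fin G.n} (hσ : σ i = false)
    {u v : G.Arc} (h : (G.stateGraph σ).Reachable u v) :
    MergedReach (G.stateGraph (Function.update σ i true)) (G.arcIn (G.overPos i))
      (G.arcOut (G.overPos i)) u v := by
  refine mergedReach_of_reachable_trade stateGraph_adj_imp_update ?_ ?_ h
  · rw [← G.flipFst_update σ i hσ]
    exact G.reachable_arcIn_flipFst _ i
  · rw [← G.flipSnd_update σ i hσ]
    exact G.reachable_arcOut_flipSnd _ i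

/-- A merge joins the two local strands: after the flip they lie on one circle (reformulation
of the proved fact `IsMergeAt.not_isSplitAt`). Viro (2004), §5.2. [cite: Viro2004, §5.2] -/
theorem IsMergeAt.reachable_update {σ : G.State} {i : Fin G.n} (h : G.IsMergeAt σ i) :
    (G.stateGraph (Function.update σ i true)).Reachable (G.arcIn (G.overPos i))
      (G.arcOut (G.overPos i)) := by
  have hns := IsMergeAt.not_isSplitAt_holds h
  unfold IsSplitAt at hns
  rw [not_and] at hns
  have := hns h.1
  rwa [circleOf, circleOf, Ne, not_not, SimpleGraph.ConnectedComponent.eq] at this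

/-- Before a merge the two local strands lie on different circles (by definition). [folklore] -/
theorem IsMergeAt.not_reachable {σ : G.State} {i : Fin G.n} (h : G.IsMergeAt σ i) :
    ¬ (G.stateGraph σ).Reachable (G.arcIn (G.overPos i)) (G.arcOut (G.overPos i)) := by
  have := h.2
  rwa [circleOf, circleOf, Ne, SimpleGraph.ConnectedComponent.eq] at this

/-- After a split the two local strands lie on different circles (by definition). [folklore] -/
theorem IsSplitAt.not_reachable_update {σ : G.State} {i : Fin G.n} (h : G.IsSplitAt σ i) :
    ¬ (G.stateGraph (Function.update σ i true)).Reachable (G.arcIn (G.overPos i))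
      (G.arcOut (G.overPos i)) := by
  have := h.2
  rwa [circleOf, circleOf, Ne, SimpleGraph.ConnectedComponent.eq] at this

/-- A split separates one circle: before the flip the two local strands lie on one circle
(contrapositive of `IsMergeAt.not_isSplitAt`). Viro (2004), §5.2. [cite: Viro2004, §5.2] -/
theorem IsSplitAt.reachable {σ : G.State} {i : Fin G.n} (h : G.IsSplitAt σ i) :
    (G.stateGraph σ).Reachable (G.arcIn (G.overPos i)) (G.arcOut (G.overPos i)) := by
  by_contra hr
  have hm : G.IsMergeAt σ i := ⟨h.1, by rwa [circleOf, circleOf, Ne, SimpleGraph.ConnectedComponent.eq]⟩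
  exact IsMergeAt.not_isSplitAt_holds hm h

/-- **Circles after a merge.** If the flip `σ → σ[i ↦ 1]` is a merge, two arcs lie on a common
circle of `σ[i ↦ 1]` iff they lie on a common circle of `σ`, or one lies on the circle of the
strand `arcIn (overPos i)` and the other on the circle of `arcOut (overPos i)`: the circles of
`σ[i ↦ 1]` are those of `σ` with these two circles united. Viro (2004), §5.2;
Bar-Natan (2002), §3.1. [cite: Viro2004, §5.2] -/
theorem IsMergeAt.reachable_update_iff {σ : G.State} {i : Fin G.n} (h : G.IsMergeAt σ i)
    (u v : G.Arc) :
    (G.stateGraph (Function.update σ i true)).Reachable u v ↔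
      MergedReach (G.stateGraph σ) (G.arcIn (G.overPos i)) (G.arcOut (G.overPos i)) u v := by
  refine reachable_trade_iff_mergedReach (stateGraph_adj_update_imp h.1)
    stateGraph_adj_imp_update (G.reachable_arcIn_flipFst σ i) (G.reachable_arcOut_flipSnd σ i)
    ?_ ?_ h.reachable_update
  · rw [← G.flipFst_update σ i h.1]
    exact G.reachable_arcIn_flipFst _ i
  · rw [← G.flipSnd_update σ i h.1]
    exact G.reachable_arcOut_flipSnd _ i

/-- **Circles before a split.** If the flip `σ → σ[i ↦ 1]` is a split, two arcs lie on a
common circle of `σ` iff they lie on a common circle of `σ[i ↦ 1]`, or one lies on the new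
circle of the strand `arcIn (overPos i)` and the other on the new circle of `arcOut (overPos i)`:
the split circle is the union of these two. Viro (2004), §5.2; Bar-Natan (2002), §3.1. [cite: Viro2004, §5.2] -/
theorem IsSplitAt.reachable_iff {σ : G.State} {i : Fin G.n} (h : G.IsSplitAt σ i)
    (u v : G.Arc) :
    (G.stateGraph σ).Reachable u v ↔
      MergedReach (G.stateGraph (Function.update σ i true)) (G.arcIn (G.overPos i))
        (G.arcOut (G.overPos i)) u v := by
  refine reachable_trade_iff_mergedReach stateGraph_adj_imp_update (stateGraph_adj_update_imp h.1)
    ?_ ?_ (G.reachable_arcIn_flipFst σ i) (G.reachable_arcOut_flipSnd σ i) h.reachable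
  · rw [← G.flipFst_update σ i h.1]
    exact G.reachable_arcIn_flipFst _ i
  · rw [← G.flipSnd_update σ i h.1]
    exact G.reachable_arcOut_flipSnd _ i

/-- Circles before a flip are contained in circles after it when the flip is a merge. [folklore] -/
theorem IsMergeAt.reachable_update_of_reachable {σ : G.State} {i : Fin G.n}
    (h : G.IsMergeAt σ i) {u v : G.Arc} (huv : (G.stateGraph σ).Reachable u v) :
    (G.stateGraph (Function.update σ i true)).Reachable u v :=
  (h.reachable_update_iff u v).2 (MergedReach.of_reachable huv)

/-- Circles after a flip are contained in circles before it when the flip is a split. [folklore] -/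
theorem IsSplitAt.reachable_of_reachable_update {σ : G.State} {i : Fin G.n}
    (h : G.IsSplitAt σ i) {u v : G.Arc}
    (huv : (G.stateGraph (Function.update σ i true)).Reachable u v) :
    (G.stateGraph σ).Reachable u v :=
  (h.reachable_iff u v).2 (MergedReach.of_reachable huv)

end GaussDiagram

end Literature.Topology.FourManifolds
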